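import Literature.Analysis.FluidPDE.SteadyNSLiouvilleGreen
import Literature.Analysis.FluidPDE.SteadyNSLiouvilleVorticityTransfer
import Literature.Analysis.FluidPDE.SteadyNSLiouvilleProofs
import Literature.Analysis.FluidPDE.VorticityCalculus
import HarnessLib

/-!
# Wang–Yang 2026, Theorem 1.6 reduces to Theorem 1.5 (vorticity decay ⇒ velocity decay)

Analysis/FluidPDE proof file (everything PROVED, no definitions, no named facts) on the discharge
path of the named fact `Literature.Analysis.FluidPDE.wangYang2026_liouville_vorticity_log`
(`SteadyNSLiouville.lean`; W. Wang, G. Yang, arXiv:2608.06040, **Theorem 1.6**). The printed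
proof (p. 22) is two lines: "Apply Proposition 4.2 with `β = 5/3`. The vorticity assumption
(1.14) gives `sup_{|x'|=r} |u(x',z)| ≤ C r^{-2/3}[log(e+r)]^{-γ}`, `r ≥ 4`. Since `u` is bounded,
enlarging the constant extends the same estimate to `1 ≤ r < 4`. Theorem 1.5 therefore applies."
Here:

* `exists_velocity_envelope_of_vorticity` — **Proposition 4.2 at `β = 5/3`, assembled**: for a
  smooth divergence-free `u` on `ℝ³` with `u → 0` at infinity and `∫ |∇u|² < ∞`, the cylindrical
  bound `|curl u(x)| ≤ C ρ^{-5/3} L(ρ)^{-γ}` (`ρ = cylRadius x ≥ 1`, `γ > 0`) implies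
  `|u(x)| ≤ C' ρ^{-2/3} L(ρ)^{-γ}` for `ρ ≥ 1`. Ingredients: the scale-free Biot–Savart bound
  `|u(x)| ≤ C₀ ∫ |x-y|⁻² |ω(y)| dy` (`exists_enorm_le_lintegral_curl_of_tendsto`,
  `SteadyNSLiouvilleGreen`), the two potential estimates `I₀`, `I₁`
  (`SteadyNSLiouvilleVorticityTransfer`, with Lemma A.2), `‖ω‖²_{L²} ≤ ‖curl‖² ∫|∇u|²`, the
  absorption `ρ^{-3/2} ≤ M ρ^{-2/3} L(ρ)^{-γ}` (`log_exp_one_add_rpow_le`), and the boundedness of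
  `u` on `1 ≤ ρ < 2`;
* `wangYang2026_liouville_vorticity_log_of_velocity_log` — **Thm 1.6 from Thm 1.5**
  (`wangYang2026_liouville_velocity_log → wangYang2026_liouville_vorticity_log`);
* `wangYang2026_liouville_vorticity_log_of_sereginWang` — composing with the tree's
  `wangYang2026_liouville_velocity_log_of_sereginWang` (`SteadyNSLiouvilleProofs`): Thm 1.6 from
  Seregin–Wang 2020, Thm 1.1 (`q = ℓ = 3`), the one remaining named fact on this path.

## References

* W. Wang, G. Yang, *New decay estimates and Liouville type theorems for the 3D axisymmetric
  stationary Navier–Stokes equations*, arXiv:2608.06040 (2026), Prop. 4.2 and the proof of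
  Thm 1.6, pp. 21–22. [WangYang2026]
-/

noncomputable section

open Real Set MeasureTheory Metric Filter
open scoped ENNReal NNReal Topology

namespace Literature.Analysis.FluidPDE

/-! ### Two elementary inputs -/

/-- A continuous field tending to `0` at infinity is bounded. [folklore] -/
theorem exists_nonneg_bound_of_tendsto_cocompact
    {u : EuclideanSpace ℝ (Fin 3) → EuclideanSpace ℝ (Fin 3)} (hu : Continuous u)
    (h0 : Tendsto u (cocompact _) (𝓝 0)) : ∃ U : ℝ, 0 ≤ U ∧ ∀ x, ‖u x‖ ≤ U := by
  have h1 : ∀ᶠ x in cocompact _, ‖u x‖ < 1 := by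
    have h := h0.norm
    rw [norm_zero] at h
    exact h (Iio_mem_nhds one_pos)
  obtain ⟨t, ht, hts⟩ := mem_cocompact.1 h1
  obtain ⟨B, hB⟩ := ht.exists_bound_of_continuousOn hu.continuousOn
  refine ⟨max B 1, le_max_of_le_right zero_le_one, fun x => ?_⟩
  by_cases hx : x ∈ t
  · exact (hB x hx).trans (le_max_left _ _)
  · exact (le_of_lt (hts hx)).trans (le_max_right _ _)

/-- `‖curl u‖²_{L²} ≤ ‖curl‖² ∫ |∇u|²_F` (pointwise `|curl u|² ≤ ‖curlCLM‖² |Du|²_F`,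
`norm_curl_sq_le_frobeniusNormSq`). [folklore] -/
theorem lintegral_rpow_enorm_curl_le_frobenius (u : EuclideanSpace ℝ (Fin 3) → EuclideanSpace ℝ (Fin 3)) :
    ∫⁻ y, ‖curl u y‖ₑ ^ (2 : ℝ) ≤
      ENNReal.ofReal (‖curlCLM‖ ^ 2) * ∫⁻ y, ENNReal.ofReal (frobeniusNormSq (fderiv ℝ u y)) := by
  rw [← lintegral_const_mul' _ _ ENNReal.ofReal_ne_top]
  refine lintegral_mono fun y => ?_
  rw [ENNReal.rpow_two, ← ofReal_norm, ← ENNReal.ofReal_pow (norm_nonneg _),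
    ← ENNReal.ofReal_mul (sq_nonneg _)]
  exact ENNReal.ofReal_le_ofReal (norm_curl_sq_le_frobeniusNormSq u y)

/-- The absorption of the near-axis term: for `ρ ≥ 1` and `γ > 0`,
`ρ^{-3/2} ≤ M (ρ^{2/3} L(ρ)^γ)⁻¹` with `M = (1 + 6γ/5)^γ L(1)^γ` (`L(ρ)^γ ≤ M ρ^{5/6}`).
[folklore] -/
theorem rpow_neg_three_halves_le {γ ρ : ℝ} (hγ : 0 < γ) (hρ : 1 ≤ ρ) :
    ρ ^ (-(3 / 2 : ℝ)) ≤ (1 + γ / (5 / 6)) ^ γ * log (exp 1 + 1) ^ γ *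
      (ρ ^ (2 / 3 : ℝ) * log (exp 1 + ρ) ^ γ)⁻¹ := by
  set M := (1 + γ / (5 / 6)) ^ γ * log (exp 1 + 1) ^ γ with hM
  have hρ0 : 0 < ρ := one_pos.trans_le hρ
  have hL1 : 0 < log (exp 1 + 1) := log_exp_one_add_pos zero_le_one
  have hLρ : 0 < log (exp 1 + ρ) := log_exp_one_add_pos hρ0.le
  have hM0 : 0 < M := by positivity
  have hlog : log (exp 1 + ρ) ^ γ ≤ M * ρ ^ (5 / 6 : ℝ) :=
    log_exp_one_add_rpow_le (by norm_num) hγ hρ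
  have hden : 0 < ρ ^ (2 / 3 : ℝ) * log (exp 1 + ρ) ^ γ := by positivity
  have h1 : ρ ^ (2 / 3 : ℝ) * log (exp 1 + ρ) ^ γ ≤ M * ρ ^ (3 / 2 : ℝ) := by
    calc ρ ^ (2 / 3 : ℝ) * log (exp 1 + ρ) ^ γ ≤ ρ ^ (2 / 3 : ℝ) * (M * ρ ^ (5 / 6 : ℝ)) :=
          mul_le_mul_of_nonneg_left hlog (by positivity)
      _ = M * (ρ ^ (2 / 3 : ℝ) * ρ ^ (5 / 6 : ℝ)) := by ring
      _ = M * ρ ^ (3 / 2 : ℝ) := by rw [← rpow_add hρ0]; norm_num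
  calc ρ ^ (-(3 / 2 : ℝ)) = M * (M * ρ ^ (3 / 2 : ℝ))⁻¹ := by
        rw [rpow_neg hρ0.le, mul_inv, ← mul_assoc, mul_inv_cancel₀ hM0.ne', one_mul]
    _ ≤ M * (ρ ^ (2 / 3 : ℝ) * log (exp 1 + ρ) ^ γ)⁻¹ :=
        mul_le_mul_of_nonneg_left (inv_anti₀ hden h1) hM0.le

/-! ### Proposition 4.2 at `β = 5/3` -/

/-- **Wang–Yang 2026, Prop. 4.2 with `β = 5/3`, and the first step of the proof of Thm 1.6.**
Let `u : ℝ³ → ℝ³` be smooth and divergence free with `u(x) → 0` as `|x| → ∞` and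
`∫ |∇u|² < ∞`, and suppose `|curl u(x)| ≤ C ρ^{-5/3} [log(e+ρ)]^{-γ}` whenever
`ρ = cylRadius x ≥ 1` (`γ > 0`). Then `|u(x)| ≤ C' ρ^{-2/3} [log(e+ρ)]^{-γ}` for `ρ ≥ 1`.
For `ρ ≥ 2`: the Biot–Savart bound `|u(x)| ≤ C₀ ∫ |x-y|⁻²|ω(y)| dy`, split at `cylRadius y = 1`
into `I₀ ≤ ‖ω‖_{L²}(8π|B̄₁|ρ⁻³)^{1/2}` and `I₁ ≤ AπK ρ^{-2/3}L(ρ)^{-γ}`, with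
`ρ^{-3/2} ≤ M ρ^{-2/3}L(ρ)^{-γ}`; for `1 ≤ ρ < 2`: `u` is bounded ("Since `u` is bounded,
enlarging the constant extends the same estimate"). [cite: WangYang2026, Prop. 4.2 and proof of Thm 1.6, pp. 21–22] -/
theorem exists_velocity_envelope_of_vorticity
    {u : EuclideanSpace ℝ (Fin 3) → EuclideanSpace ℝ (Fin 3)} (hu : ContDiff ℝ ((⊤ : ℕ∞) : WithTop ℕ∞) u)
    (hdiv : VectorCalculus.IsDivFree u) (h0 : Tendsto u (cocompact _) (𝓝 0))
    (hD : ∫⁻ x, ENNReal.ofReal (frobeniusNormSq (fderiv ℝ u x)) < ∞) {C γ : ℝ} (hγ : 0 < γ)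
    (hω : ∀ x, 1 ≤ cylRadius x →
      ‖curl u x‖ ≤ C / (cylRadius x ^ (5 / 3 : ℝ) * log (exp 1 + cylRadius x) ^ γ)) :
    ∃ C' : ℝ, ∀ x, 1 ≤ cylRadius x →
      ‖u x‖ ≤ C' / (cylRadius x ^ (2 / 3 : ℝ) * log (exp 1 + cylRadius x) ^ γ) := by
  -- constants
  obtain ⟨C₀, hC₀⟩ := exists_enorm_le_lintegral_curl_of_tendsto
  obtain ⟨K, hK0, hK⟩ :=
    exists_lintegral_planar_logRiesz_le (β := 5 / 3) (γ := γ) (by norm_num) (by norm_num) hγ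
  obtain ⟨U, hU0, hU⟩ := exists_nonneg_bound_of_tendsto_cocompact hu.continuous h0
  set A : ℝ := max C 0 with hA
  have hA0 : 0 ≤ A := le_max_right _ _
  -- the `L²` norm of the vorticity
  set E : ℝ≥0∞ := ∫⁻ y, ‖curl u y‖ₑ ^ (2 : ℝ) with hEdef
  have hEtop : E ≠ ⊤ :=
    ne_top_of_le_ne_top (ENNReal.mul_ne_top ENNReal.ofReal_ne_top hD.ne) (lintegral_rpow_enorm_curl_le_frobenius u)
  set e : ℝ := E.toReal with he
  have he0 : 0 ≤ e := ENNReal.toReal_nonneg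
  have hEe : E = ENNReal.ofReal e := (ENNReal.ofReal_toReal hEtop).symm
  -- the area of the unit disc
  set V : ℝ≥0∞ := volume (closedBall (0 : EuclideanSpace ℝ (Fin 2)) 1) with hVdef
  have hVtop : V ≠ ⊤ := measure_closedBall_lt_top.ne
  set v : ℝ := V.toReal with hv
  have hv0 : 0 ≤ v := ENNReal.toReal_nonneg
  have hVv : V = ENNReal.ofReal v := (ENNReal.ofReal_toReal hVtop).symm
  -- the vorticity hypothesis on the far region, with the nonnegative constant `A`
  have hωA : ∀ y, 1 < cylRadius y →
      ‖curl u y‖ ≤ A / (cylRadius y ^ (5 / 3 : ℝ) * log (exp 1 + cylRadius y) ^ γ) := by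
    intro y hy
    have hy0 : 0 < cylRadius y := one_pos.trans hy
    have hL : 0 < log (exp 1 + cylRadius y) := log_exp_one_add_pos hy0.le
    exact (hω y hy.le).trans (div_le_div_of_nonneg_right (le_max_left C 0) (by positivity))
  have hωm : Measurable fun y => ‖curl u y‖ₑ :=
    (continuous_curl (hu.of_le (by norm_cast))).measurable.enorm
  -- the constants of the conclusion
  set M₁ : ℝ := (1 + γ / (5 / 6)) ^ γ * log (exp 1 + 1) ^ γ with hM₁
  have hM₁0 : 0 ≤ M₁ := by
    have := log_exp_one_add_pos (zero_le_one : (0 : ℝ) ≤ 1)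
    positivity
  set c₁ : ℝ := e ^ (1 / 2 : ℝ) * (8 * π * v) ^ (1 / 2 : ℝ) with hc₁
  have hc₁0 : 0 ≤ c₁ := by positivity
  set c₂ : ℝ := A * π * K with hc₂
  have hc₂0 : 0 ≤ c₂ := by positivity
  set Cfar : ℝ := (C₀ : ℝ) * (c₁ * M₁ + c₂) with hCfar
  have hCfar0 : 0 ≤ Cfar := by positivity
  set Cnear : ℝ := U * (2 ^ (2 / 3 : ℝ) * log (exp 1 + 2) ^ γ) with hCnear
  refine ⟨max Cfar Cnear, fun x hx1 => ?_⟩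
  set ρ := cylRadius x with hρ
  have hρ0 : 0 < ρ := one_pos.trans_le hx1
  have hLρ : 0 < log (exp 1 + ρ) := log_exp_one_add_pos hρ0.le
  set den : ℝ := ρ ^ (2 / 3 : ℝ) * log (exp 1 + ρ) ^ γ with hden
  have hden0 : 0 < den := by positivity
  rcases le_or_gt 2 ρ with hρ2 | hρ2
  · -- `ρ ≥ 2`: the potential estimates
    have hI₀ := lintegral_near_le_of_cylRadius (ω := curl u) hωm (x := x) hρ2
    have hI₁ := lintegral_far_le_of_cylRadius (β := 5 / 3) (γ := γ) (A := A) (K := K) hA0 hK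
      (ω := curl u) hωA (x := x) hρ2
    -- real forms of the two bounds
    have hI₀' : (∫⁻ y, ‖curl u y‖ₑ ^ (2 : ℝ)) ^ (1 / 2 : ℝ) *
        (ENNReal.ofReal (8 * π * (cylRadius x)⁻¹ ^ 3) *
          volume (closedBall (0 : EuclideanSpace ℝ (Fin 2)) 1)) ^ (1 / 2 : ℝ) ≤
        ENNReal.ofReal (c₁ * M₁ * den⁻¹) := by
      rw [← hEdef, ← hVdef, hEe, hVv, ← ENNReal.ofReal_mul (by positivity),
        ENNReal.ofReal_rpow_of_nonneg he0 (by norm_num),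
        ENNReal.ofReal_rpow_of_nonneg (by positivity) (by norm_num), ← ENNReal.ofReal_mul (by positivity)]
      refine ENNReal.ofReal_le_ofReal ?_
      have hsplit : (8 * π * ρ⁻¹ ^ 3 * v) ^ (1 / 2 : ℝ) =
          (8 * π * v) ^ (1 / 2 : ℝ) * (ρ⁻¹ ^ 3) ^ (1 / 2 : ℝ) := by
        rw [← mul_rpow (by positivity) (by positivity)]; ring_nf
      have hpow : (ρ⁻¹ ^ 3) ^ (1 / 2 : ℝ) = ρ ^ (-(3 / 2 : ℝ)) := by
        rw [inv_pow, ← rpow_natCast ρ 3, ← rpow_neg_one, ← rpow_mul hρ0.le, ← rpow_mul hρ0.le]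
        norm_num
      rw [← hρ, hsplit, hpow]
      calc e ^ (1 / 2 : ℝ) * ((8 * π * v) ^ (1 / 2 : ℝ) * ρ ^ (-(3 / 2 : ℝ)))
          = c₁ * ρ ^ (-(3 / 2 : ℝ)) := by rw [hc₁]; ring
        _ ≤ c₁ * (M₁ * den⁻¹) :=
            mul_le_mul_of_nonneg_left (rpow_neg_three_halves_le hγ hx1) hc₁0
        _ = c₁ * M₁ * den⁻¹ := by ring
    have hI₁' : ENNReal.ofReal (A * π * K * (cylRadius x ^ (1 - 5 / 3 : ℝ) / log (exp 1 + cylRadius x) ^ γ)) =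
        ENNReal.ofReal (c₂ * den⁻¹) := by
      congr 1
      rw [← hρ, hc₂, hden]
      have : ρ ^ (1 - 5 / 3 : ℝ) = (ρ ^ (2 / 3 : ℝ))⁻¹ := by
        rw [← rpow_neg hρ0.le]; norm_num
      rw [this, mul_inv, div_eq_mul_inv]
    -- split the Biot–Savart integral
    have hSc : {y : EuclideanSpace ℝ (Fin 3) | cylRadius y ≤ 1}ᶜ = {y | 1 < cylRadius y} := by
      ext y; simp [not_le]
    have hsplit := (lintegral_add_compl (μ := volume)
      (fun y => ENNReal.ofReal (‖x - y‖ ^ (-(2 : ℝ))) * ‖curl u y‖ₑ) measurableSet_cylRadius_le_one).symm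
    rw [hSc] at hsplit
    have hux : ‖u x‖ₑ ≤ ENNReal.ofReal (Cfar * den⁻¹) := by
      calc ‖u x‖ₑ ≤ C₀ * ∫⁻ y, ENNReal.ofReal (‖x - y‖ ^ (-(2 : ℝ))) * ‖curl u y‖ₑ := hC₀ hu hdiv h0 x
        _ = C₀ * ((∫⁻ y in {y | cylRadius y ≤ 1}, ENNReal.ofReal (‖x - y‖ ^ (-(2 : ℝ))) * ‖curl u y‖ₑ) +
              ∫⁻ y in {y | 1 < cylRadius y}, ENNReal.ofReal (‖x - y‖ ^ (-(2 : ℝ))) * ‖curl u y‖ₑ) := by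
            rw [hsplit]
        _ ≤ C₀ * (ENNReal.ofReal (c₁ * M₁ * den⁻¹) + ENNReal.ofReal (c₂ * den⁻¹)) := by
            gcongr
            · exact hI₀.trans hI₀'
            · exact hI₁.trans_eq hI₁'
        _ = ENNReal.ofReal (Cfar * den⁻¹) := by
            rw [← ENNReal.ofReal_add (by positivity) (by positivity), ← ENNReal.ofReal_coe_nnreal,
              ← ENNReal.ofReal_mul C₀.coe_nonneg]
            congr 1
            rw [hCfar]
            ring
    rw [← ofReal_norm, ENNReal.ofReal_le_ofReal_iff (by positivity)] at hux
    calc ‖u x‖ ≤ Cfar * den⁻¹ := hux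
      _ ≤ max Cfar Cnear * den⁻¹ := mul_le_mul_of_nonneg_right (le_max_left _ _) (by positivity)
      _ = max Cfar Cnear / den := (div_eq_mul_inv _ _).symm
  · -- `1 ≤ ρ < 2`: `u` is bounded
    have hL2 : 0 < log (exp 1 + 2) := log_exp_one_add_pos zero_le_two
    have hd2 : 0 < 2 ^ (2 / 3 : ℝ) * log (exp 1 + 2) ^ γ := by positivity
    have hden2 : den ≤ 2 ^ (2 / 3 : ℝ) * log (exp 1 + 2) ^ γ :=
      mul_le_mul (rpow_le_rpow hρ0.le hρ2.le (by norm_num))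
        (rpow_le_rpow hLρ.le (log_exp_one_add_mono hρ0.le hρ2.le) hγ.le)
        (by positivity) (by positivity)
    calc ‖u x‖ ≤ U := hU x
      _ = U * (2 ^ (2 / 3 : ℝ) * log (exp 1 + 2) ^ γ) / (2 ^ (2 / 3 : ℝ) * log (exp 1 + 2) ^ γ) :=
          (mul_div_cancel_right₀ U hd2.ne').symm
      _ ≤ Cnear / den := div_le_div_of_nonneg_left (mul_nonneg hU0 hd2.le) hden0 hden2
      _ ≤ max Cfar Cnear / den := div_le_div_of_nonneg_right (le_max_right _ _) hden0.le

/-! ### Theorem 1.6 from Theorem 1.5 -/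

/-- **Wang–Yang 2026, Theorem 1.6 from Theorem 1.5.** The named fact
`wangYang2026_liouville_velocity_log` (Thm 1.5) implies the named fact
`wangYang2026_liouville_vorticity_log` (Thm 1.6): a smooth steady solution with finite Dirichlet
integral, `u → 0` at infinity and the vorticity bound (1.14) satisfies the velocity bound (1.13)
with the same `γ > 1/3` (`exists_velocity_envelope_of_vorticity`, i.e. Prop. 4.2 with
`β = 5/3`), "Theorem 1.5 therefore applies, and `γ > 1/3` yields `u ≡ 0`" (p. 22).
[cite: WangYang2026, Thm 1.6 (proof), p. 22] -/
theorem wangYang2026_liouville_vorticity_log_of_velocity_log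
    (h : wangYang2026_liouville_velocity_log) : wangYang2026_liouville_vorticity_log := by
  intro u p hprof hu hp hD hlim hω
  obtain ⟨C, γ, hγ, hωb⟩ := hω
  obtain ⟨C', hC'⟩ := exists_velocity_envelope_of_vorticity hu hprof.divFree hlim hD
    (by linarith : 0 < γ) hωb
  exact h u p hprof hu hp hD hlim ⟨C', γ, hγ, hC'⟩

/-- **Wang–Yang 2026, Theorem 1.6 from Seregin–Wang 2020, Theorem 1.1 (`q = ℓ = 3`)**: the
named fact `sereginWang_liouville_L3_annulus` implies `wangYang2026_liouville_vorticity_log`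
(through Thm 1.5, `wangYang2026_liouville_velocity_log_of_sereginWang`). This is the complete
reduction of Thm 1.6 to the one Caccioppoli-type input of the theory. [cite: WangYang2026, Thm 1.6 (proof), p. 22] -/
theorem wangYang2026_liouville_vorticity_log_of_sereginWang
    (h : sereginWang_liouville_L3_annulus) : wangYang2026_liouville_vorticity_log :=
  wangYang2026_liouville_vorticity_log_of_velocity_log (wangYang2026_liouville_velocity_log_of_sereginWang h)

end Literature.Analysis.FluidPDE

end
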